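/-
Copyright (c) 2026. All rights reserved.
Released under Apache 2.0 license as described in the file LICENSE.
Authors: abc-iut cell, campaign-S prover seat abc-iut-S1 (wave 1, gen 7).
-/
import Summits.ABC.IUTFork.Cor312Ind3IteratesVacuityDyadicQuartic
import Literature.IUT.LogVolume.UnitLogWildDyadicOcticGaussian
import HarnessLib

/-!
# (Ind3) honest iterates at a dyadic `(e, f) = (8, 1)`-place of a field containing `√−1`: depth `2` can be INHABITED

Proof-only sequel (theorems, no definitions) of `Cor312Ind3IteratesVacuityDyadicQuartic.lean` (abc-iut-S1:
for `F ∋ √−1` — the fields of [IUTchI] Def. 3.1 — every `(4, 1)`-place over `2` has EMPTY honest depth-`≥ 2`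
(Ind3) iterate images).  That emptiness does not persist to `(8, 1)`: transporting abc-iut-S1's local
`WildDyadicQuartic.norm_unitLog_eq_one_of_pow_eight_eq_neg` (`α⁸ = −25 ⇒ ‖log₂ α‖ = 1`, any `K/ℚ₂`):

* `Real.nonarchIterImage_analyticLogv_two_nonempty_of_pow_eight_eq_neg` — **`F ∋ α` with `α⁸ = −25`
  (so `F ∋ √−1 = α⁴/5`), `v ∣ 2` ⇒ the honest depth-`2` image at `v` is INHABITED**;
* `exists_numberField_octic_gaussian_dyadic_two_nonempty` — **`F = ℚ(⁸√−25) = ℚ(√−1, ⁴√(5√−1))`: `F ∋ √−1`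
  and its place over `2` has `(e, f) = (8, 1)` with INHABITED depth `2`** (`e ≥ 8` from
  `‖(α − 1)⁸‖_v = ‖2‖_v`).

So for the fields of [IUTchI] Def. 3.1 the dyadic census at `f(v|2) = 1` reads: `e ≡ 2 (mod 4)` ⇒ `∅`
(abc-iut-w5-d017); `e = 4` ⇒ `∅` (parent file); `e = 8` ⇒ inhabited instances exist (this file).  Honest
framing: statements ABOUT THE MODEL; classical local arithmetic underneath; nothing here asserts or denies
[IUTchIII] Cor. 3.12 or takes a side; census ≠ verdict; typed ≠ proved.  No definitions, no Prop-valued fact.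
-/

noncomputable section

open Set

namespace Summit.ABC.IUTFork.Thm311.Real

open NumberField IsDedekindDomain Literature.IUT.LogVolume Literature.IUT.LogThetaLattice
  Literature.NumberTheory.NumberFields Polynomial

variable {F : Type} [Field F] [NumberField F]

/-! ## 1. `F ∋ α`, `α⁸ = −25`: depth `2` is inhabited at every `v ∣ 2` -/

/-- In the rescaled completion at a place over `2`: `α⁸ = −25 ⇒ ‖α‖ = 1 ∧ ‖log₂ α‖ = 1`.
[cite: Koblitz1984, Ch. IV §2] -/
theorem norm_rescaled_unitLog_eq_one_of_pow_eight_eq_neg (v : HeightOneSpectrum (𝓞 F)) (p : ℕ)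
    [Fact p.Prime] (hv : ((p : ℕ) : 𝓞 F) ∈ v.asIdeal) (hp2 : p = 2) {α : RescaledCompletion F p v hv}
    (hα : α ^ 8 = -25) : ‖α‖ = 1 ∧ ‖unitLog α‖ = 1 := by
  subst hp2
  have h25 : ‖(25 : RescaledCompletion F 2 v hv)‖ = 1 := by
    rw [show (25 : RescaledCompletion F 2 v hv) = ((25 : ℕ) : RescaledCompletion F 2 v hv) by norm_cast]
    exact norm_natCast_eq_one_of_not_dvd 2 (by norm_num)
  have hα1 : ‖α‖ = 1 := by
    have h1 : ‖α‖ ^ 8 = 1 := by rw [← norm_pow, hα, norm_neg, h25]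
    exact (pow_eq_one_iff_of_nonneg (norm_nonneg α) (by norm_num)).mp h1
  exact ⟨hα1, WildDyadicQuartic.norm_unitLog_eq_one_of_pow_eight_eq_neg hα⟩

/-- **`F ∋ α` with `α⁸ = −25` (so `F ∋ √−1`), `v ∣ 2` ⇒ the honest depth-`2` (Ind3) iterate image at `v` is
NONEMPTY.** [claim: Mochizuki2012, status: disputed] -/
theorem nonarchIterImage_analyticLogv_two_nonempty_of_pow_eight_eq_neg (v : HeightOneSpectrum (𝓞 F))
    (h2 : ((2 : ℕ) : 𝓞 F) ∈ v.asIdeal) {α : F} (hα : α ^ 8 = -25) :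
    (nonarchIterImage (analyticLogv F) v 2).Nonempty := by
  haveI : Fact (residueChar F v).Prime := ⟨residueChar_prime F v⟩
  have hp : residueChar F v = 2 := residueChar_eq_of_prime_natCast_mem v Nat.prime_two h2
  set y : v.adicCompletion F := algebraMap F (v.adicCompletion F) α with hy
  have hα' : (RescaledCompletion.of F (residueChar F v) v (natCast_residueChar_mem F v) y) ^ 8 = -25 := by
    rw [← map_pow, hy, ← map_pow, hα, map_neg, map_ofNat, map_neg, map_ofNat]
  obtain ⟨hy1, hylog⟩ := norm_rescaled_unitLog_eq_one_of_pow_eight_eq_neg v (residueChar F v)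
    (natCast_residueChar_mem F v) hp hα'
  obtain ⟨w, hw⟩ := exists_unit_coe_eq_of_norm_rescaled_eq_one v (residueChar F v)
    (natCast_residueChar_mem F v) y hy1
  have hlog : ‖RescaledCompletion.of F (residueChar F v) v (natCast_residueChar_mem F v)
      (analyticLogv F v (Additive.ofMul w))‖ = 1 := by
    rw [analyticLogv_apply, RingEquiv.apply_symm_apply, hw]
    exact hylog
  obtain ⟨u, hu⟩ := exists_unit_coe_eq_of_norm_rescaled_eq_one v (residueChar F v)
    (natCast_residueChar_mem F v) (analyticLogv F v (Additive.ofMul w)) hlog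
  exact nonarchIterImage_two_nonempty_of_exists_eq_coe_unit (analyticLogv F) v ⟨w, u, hu.symm⟩

/-! ## 2. F-level: `ℚ(⁸√−25)`, a field with `√−1` and an inhabited `(8, 1)`-place -/

/-- In the rescaled completion at a place over `p = 2`: `‖x‖ⁿ = 1/2`, `n ≥ 1` ⇒ `n ≤ e`.
[cite: NeukirchANT1999, Ch. II (5.5)] -/
theorem le_absRamificationIdx_rescaled_of_norm_pow (v : HeightOneSpectrum (𝓞 F)) (p : ℕ) [Fact p.Prime]
    (hv : ((p : ℕ) : 𝓞 F) ∈ v.asIdeal) (hp2 : p = 2) {n : ℕ} (hn : 0 < n)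
    (x : RescaledCompletion F p v hv) (hnorm : ‖x‖ ^ n = 2⁻¹) :
    n ≤ absRamificationIdx p (RescaledCompletion F p v hv) := by
  subst hp2
  have hxlt : ‖x‖ < 1 :=
    (pow_lt_one_iff_of_nonneg (norm_nonneg _) hn.ne').mp (by rw [hnorm]; norm_num)
  have hdisc := norm_le_rpow_of_norm_lt_one 2 (RescaledCompletion F 2 v hv) hxlt
  set e := absRamificationIdx 2 (RescaledCompletion F 2 v hv) with hedef
  have he0 : (0 : ℝ) < e := by exact_mod_cast absRamificationIdx_pos 2 (RescaledCompletion F 2 v hv)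
  have h4 : ‖x‖ ^ n ≤ ((2 : ℝ) ^ (-(1 / (e : ℝ)))) ^ n := pow_le_pow_left₀ (norm_nonneg _) hdisc n
  rw [hnorm, ← Real.rpow_natCast, ← Real.rpow_mul (by norm_num), ← Real.rpow_neg_one,
    Real.rpow_le_rpow_left_iff (by norm_num : (1 : ℝ) < 2)] at h4
  have hege : (n : ℝ) ≤ e := by
    have h := mul_le_mul_of_nonneg_right h4 he0.le
    field_simp at h
    linarith
  exact_mod_cast hege

/-- **`α⁸ = −25` in `K_v`, `2 ∈ 𝔭_v` ⇒ `8 ≤ e(v|2)`**: `(α − 1)⁸ = (70α⁴ − 24) + 4(−2α⁷ + 7α⁶ − 14α⁵ − 14α³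
+ 7α² − 2α)` has norm `‖2‖`. [cite: NeukirchANT1999, Ch. II (5.5)] -/
theorem eight_le_ramificationIdx_of_pow_eight_eq_neg (v : HeightOneSpectrum (𝓞 F))
    (h2 : ((2 : ℕ) : 𝓞 F) ∈ v.asIdeal) (x : v.adicCompletion F) (hx : x ^ 8 = -25) :
    8 ≤ v.asIdeal.ramificationIdx ℤ := by
  set α : RescaledCompletion F 2 v h2 := RescaledCompletion.of F 2 v h2 x with hαdef
  have hα : α ^ 8 = -25 := by rw [hαdef, ← map_pow, hx, map_neg, map_ofNat]
  have hodd : ∀ {n : ℕ}, n % 2 = 1 → ‖(n : RescaledCompletion F 2 v h2)‖ = 1 := fun hn ↦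
    norm_natCast_eq_one_of_not_dvd 2 (by omega)
  have hle : ∀ n : ℕ, ‖(n : RescaledCompletion F 2 v h2)‖ ≤ 1 := fun n ↦ by
    rw [norm_natCast_eq_padicNorm 2 (RescaledCompletion F 2 v h2) n]
    exact_mod_cast Padic.norm_int_le_one (n : ℤ)
  have hα1 : ‖α‖ = 1 := (norm_rescaled_unitLog_eq_one_of_pow_eight_eq_neg v 2 h2 rfl hα).1
  have hid : (α - 1) ^ 8 = (70 * α ^ 4 - 24)
      + 4 * (-2 * α ^ 7 + 7 * α ^ 6 + -14 * α ^ 5 + -14 * α ^ 3 + 7 * α ^ 2 + -2 * α) := by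
    have hexp : (α - 1) ^ 8 = α ^ 8 - 8 * α ^ 7 + 28 * α ^ 6 - 56 * α ^ 5 + 70 * α ^ 4 - 56 * α ^ 3
        + 28 * α ^ 2 - 8 * α + 1 := by ring
    rw [hexp, hα]
    ring
  have hmain : ‖(70 : RescaledCompletion F 2 v h2) * α ^ 4 - 24‖ = 2⁻¹ := by
    rw [show (70 : RescaledCompletion F 2 v h2) * α ^ 4 - 24 = 2 * (35 * α ^ 4 + -12) by ring, norm_mul,
      WildDyadic.norm_two]
    have h35 : ‖(35 : RescaledCompletion F 2 v h2) * α ^ 4‖ = 1 := by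
      rw [norm_mul, norm_pow, hα1, one_pow, mul_one,
        show (35 : RescaledCompletion F 2 v h2) = ((35 : ℕ) : RescaledCompletion F 2 v h2) by norm_cast]
      exact hodd (by norm_num)
    have h12 : ‖(-12 : RescaledCompletion F 2 v h2)‖ < 1 := by
      rw [norm_neg, show (12 : RescaledCompletion F 2 v h2) = 4 * 3 by norm_num, norm_mul,
        UnramifiedDyadic.norm_four,
        show (3 : RescaledCompletion F 2 v h2) = ((3 : ℕ) : RescaledCompletion F 2 v h2) by norm_cast,
        hodd (by norm_num)]
      norm_num
    have hne : ‖(35 : RescaledCompletion F 2 v h2) * α ^ 4‖ ≠ ‖(-12 : RescaledCompletion F 2 v h2)‖ := by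
      rw [h35]; exact (ne_of_lt h12).symm
    rw [IsUltrametricDist.norm_add_eq_max_of_norm_ne_norm hne, h35, max_eq_left (h35 ▸ h12.le)]
    norm_num
  have hmono : ∀ (c k : ℕ), ‖(c : RescaledCompletion F 2 v h2) * α ^ k‖ ≤ 1 := fun c k ↦ by
    rw [norm_mul, norm_pow, hα1, one_pow, mul_one]; exact hle c
  have hmono' : ∀ (c k : ℕ), ‖-(c : RescaledCompletion F 2 v h2) * α ^ k‖ ≤ 1 := fun c k ↦ by
    rw [neg_mul, norm_neg]; exact hmono c k
  have hult : ∀ a b : RescaledCompletion F 2 v h2, ‖a‖ ≤ 1 → ‖b‖ ≤ 1 → ‖a + b‖ ≤ 1 := fun a b ha hb ↦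
    (IsUltrametricDist.norm_add_le_max a b).trans (max_le ha hb)
  have hpoly : ‖(-2 : RescaledCompletion F 2 v h2) * α ^ 7 + 7 * α ^ 6 + -14 * α ^ 5 + -14 * α ^ 3
      + 7 * α ^ 2 + -2 * α‖ ≤ 1 := by
    refine hult _ _ (hult _ _ (hult _ _ (hult _ _ (hult _ _ ?_ ?_) ?_) ?_) ?_) ?_
    · exact_mod_cast hmono' 2 7
    · exact_mod_cast hmono 7 6
    · exact_mod_cast hmono' 14 5
    · exact_mod_cast hmono' 14 3
    · exact_mod_cast hmono 7 2
    · have := hmono' 2 1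
      rw [pow_one] at this
      exact_mod_cast this
  have htail : ‖(4 : RescaledCompletion F 2 v h2) * (-2 * α ^ 7 + 7 * α ^ 6 + -14 * α ^ 5 + -14 * α ^ 3
      + 7 * α ^ 2 + -2 * α)‖ ≤ 4⁻¹ := by
    rw [norm_mul, UnramifiedDyadic.norm_four]
    calc (4⁻¹ : ℝ) * _ ≤ 4⁻¹ * 1 := by gcongr
      _ = 4⁻¹ := mul_one _
  have hnorm : ‖α - 1‖ ^ 8 = 2⁻¹ := by
    rw [← norm_pow, hid]
    have hlt : ‖(4 : RescaledCompletion F 2 v h2) * (-2 * α ^ 7 + 7 * α ^ 6 + -14 * α ^ 5 + -14 * α ^ 3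
        + 7 * α ^ 2 + -2 * α)‖ < ‖(70 : RescaledCompletion F 2 v h2) * α ^ 4 - 24‖ := by
      rw [hmain]; exact htail.trans_lt (by norm_num)
    rw [IsUltrametricDist.norm_add_eq_max_of_norm_ne_norm (ne_of_gt hlt), max_eq_left hlt.le, hmain]
  have h := le_absRamificationIdx_rescaled_of_norm_pow v 2 h2 rfl (by norm_num : 0 < 8) (α - 1) hnorm
  rwa [absRamificationIdx_rescaledCompletion] at h

/-- **`F = ℚ[X]/(g)`, `g` an irreducible factor of `X⁸ + 25`**: a number field of degree `≤ 8` with `α⁸ = −25`.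
[folklore] -/
theorem exists_numberField_pow_eight_eq_neg_finrank_le :
    ∃ (F : Type) (_ : Field F) (_ : NumberField F) (α : F), α ^ 8 = -25 ∧ Module.finrank ℚ F ≤ 8 := by
  let f : ℚ[X] := X ^ 8 + C (25 : ℚ)
  have hf : f.natDegree = 8 := natDegree_X_pow_add_C
  have hfne : f.natDegree ≠ 0 := by rw [hf]; norm_num
  haveI : Fact (Irreducible f.factor) := ⟨irreducible_factor f⟩
  have hg0 : f.factor ≠ 0 := (irreducible_factor f).ne_zero
  haveI : Module.Finite ℚ (AdjoinRoot f.factor) := (AdjoinRoot.powerBasis hg0).finite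
  haveI : CharZero (AdjoinRoot f.factor) :=
    charZero_of_injective_algebraMap (algebraMap ℚ (AdjoinRoot f.factor)).injective
  haveI : NumberField (AdjoinRoot f.factor) := NumberField.mk
  refine ⟨AdjoinRoot f.factor, inferInstance, inferInstance, AdjoinRoot.root f.factor, ?_, ?_⟩
  · have hdvd : f.factor ∣ f := factor_dvd_of_natDegree_ne_zero hfne
    have halg : algebraMap ℚ (AdjoinRoot f.factor) = AdjoinRoot.of f.factor := Subsingleton.elim _ _
    have hroot : aeval (AdjoinRoot.root f.factor) f.factor = 0 := by
      rw [aeval_def, halg]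
      exact AdjoinRoot.eval₂_root f.factor
    have h0 : aeval (AdjoinRoot.root f.factor) f = 0 := aeval_eq_zero_of_dvd_aeval_eq_zero hdvd hroot
    have h1 : aeval (AdjoinRoot.root f.factor) f = AdjoinRoot.root f.factor ^ 8 + 25 := by
      simp [f, map_ofNat]
    rw [h1] at h0
    linear_combination h0
  · rw [(AdjoinRoot.powerBasis hg0).finrank, AdjoinRoot.powerBasis_dim, ← hf]
    exact natDegree_le_of_dvd (factor_dvd_of_natDegree_ne_zero hfne)
      (monic_X_pow_add_C (25 : ℚ) (by norm_num)).ne_zero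

/-- **`ℚ(⁸√−25) = ℚ(√−1, ⁴√(5√−1))`: a number field CONTAINING `√−1` with a place over `2` of type
`(e, f) = (8, 1)` at which the honest depth-`2` (Ind3) iterate image is INHABITED** — so for the fields of
[IUTchI] Def. 3.1 the `(4,1)`-emptiness (`Cor312Ind3IteratesVacuityDyadicQuartic`) does not persist to `(8,1)`.
[claim: Mochizuki2012, status: disputed] -/
theorem exists_numberField_octic_gaussian_dyadic_two_nonempty :
    ∃ (F : Type) (_ : Field F) (_ : NumberField F) (v : HeightOneSpectrum (𝓞 F)),
      (∃ i : F, i ^ 2 = -1) ∧ residueChar F v = 2 ∧ v.asIdeal.ramificationIdx ℤ = 8 ∧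
        v.asIdeal.inertiaDeg ℤ = 1 ∧ (nonarchIterImage (analyticLogv F) v 2).Nonempty := by
  obtain ⟨F, _, _, α, hα, hdeg⟩ := exists_numberField_pow_eight_eq_neg_finrank_le
  obtain ⟨v, hv⟩ := exists_heightOneSpectrum_natCast_mem' (F := F) Nat.prime_two
  have hx : (algebraMap F (v.adicCompletion F) α) ^ 8 = -25 := by rw [← map_pow, hα, map_neg, map_ofNat]
  have h8 : 8 ≤ v.asIdeal.ramificationIdx ℤ := eight_le_ramificationIdx_of_pow_eight_eq_neg v hv _ hx
  have hef : v.asIdeal.ramificationIdx ℤ * v.asIdeal.inertiaDeg ℤ ≤ 8 :=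
    (ramificationIdx_mul_inertiaDeg_le_finrank' v).trans hdeg
  haveI := v.isPrime
  have hfpos : 0 < v.asIdeal.inertiaDeg ℤ := Ideal.inertiaDeg_pos (R := ℤ) (q := v.asIdeal)
  have he : v.asIdeal.ramificationIdx ℤ = 8 := by nlinarith
  have hf : v.asIdeal.inertiaDeg ℤ = 1 := by nlinarith
  -- `√−1 = α⁴/5 ∈ F`
  have h5 : (5 : F) ≠ 0 := by norm_num
  have hi : (α ^ 4 / 5) ^ 2 = -1 := by
    rw [div_pow, ← pow_mul, show 4 * 2 = 8 by rfl, hα]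
    field_simp
    norm_num
  exact ⟨F, inferInstance, inferInstance, v, ⟨α ^ 4 / 5, hi⟩,
    residueChar_eq_of_prime_natCast_mem v Nat.prime_two hv, he, hf,
    nonarchIterImage_analyticLogv_two_nonempty_of_pow_eight_eq_neg v hv hα⟩

end Summit.ABC.IUTFork.Thm311.Real

end
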